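import Mathlib
import Literature.Analysis.FluidPDE.StretchingRateDynamics
import Literature.Analysis.FluidPDE.TaoAveragedNondegeneracy

/-!
# Clause 13-R: the RATE COLUMN along a straight filament grows linearly — `‖P_n(e₃ × X(τ))‖ ≥ |τ|·√(1 − (1−θ₀)²) − ‖x₀‖`

Route `FilamentSkeletonRss`, Variant A1R (items 23610–23612; DIRECTOR-NS dss_113–115; critic idea-crit-7 PR-1 «13-R pins a = 0»): the 13-R tail borders
the linearised normal-velocity map by the rate column `R_j(τ) = e₃ × X_j(τ) − ⟪e₃ × X_j(τ), X_j′(τ)⟫X_j′(τ)` and asks `|dα|√Γ ≤ cnd·L` whenever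
`‖DT·Y − dα·R_j‖ ≤ L(1+|τ−c_j|)^a` on the ball.  PR-1's calibration rests on the growth of `R_j` along the filament: for a STRAIGHT filament
`X(τ) = x₀ + τ·t` (`‖t‖ = 1`, tilt `|⟪t, e₃⟫| ≤ 1 − θ₀`) the column is `R(τ) = P_t(e₃ × x₀) + τ·(e₃ × t)` (the normal projection `P_t v = v − ⟪v,t⟫t` fixes
`e₃ × t ⟂ t`), `‖e₃ × t‖² = 1 − ⟪t, e₃⟫² ≥ 1 − (1−θ₀)² = θ₀(2−θ₀)`, hence `‖R(τ)‖ ≥ |τ|·√(θ₀(2−θ₀)) − ‖x₀‖`: on the tangency ball `|τ| ≤ R_b√(Γ log Γ)`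
the sup of `‖R‖` is `≍ R_b√(Γ log Γ)`, so the `Y ≡ 0` instance of 13-R reads `cnd·L ≥ √Γ·|dα|` against `L ≍ |dα|·R_b√(Γ log Γ)^{1−a}·√θ₀` — consistent for
all large `Γ` iff `a = 0` (PR-1).  Typing-agnostic; lane ns-filament-19175-p1 g14; `--supports stmt-NavierStokesRegularity-23612 --as helper`.
HONEST FRAMING: elementary vector algebra attached to a HYPOTHETICAL filament skeleton on the NEGATIVE side of a MODEL route; nothing here bears on
Navier–Stokes regularity or blow-up.
-/

noncomputable section

open Real Literature.Analysis.FluidPDE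
open scoped RealInnerProductSpace

namespace Summit.NavierStokesRegularity.NavierStokesRegularity.Theorems.MatchedKernel
set_option linter.dupNamespace false

/-- The normal projection `P_t v = v − ⟪v, t⟫ t` along a unit vector is a contraction: `‖P_t v‖ ≤ ‖v‖`. [folklore] -/
theorem norm_sub_inner_smul_le (v t : EuclideanSpace ℝ (Fin 3)) (ht : ‖t‖ = 1) : ‖v - ⟪v, t⟫ • t‖ ≤ ‖v‖ := by
  have h : ‖v - ⟪v, t⟫ • t‖ ^ 2 = ‖v‖ ^ 2 - ⟪v, t⟫ ^ 2 := by
    rw [@norm_sub_sq_real, norm_smul, Real.norm_eq_abs, ht, mul_one, sq_abs, inner_smul_right]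
    ring
  have h2 : ‖v - ⟪v, t⟫ • t‖ ^ 2 ≤ ‖v‖ ^ 2 := by rw [h]; nlinarith [sq_nonneg ⟪v, t⟫]
  exact (pow_le_pow_iff_left₀ (norm_nonneg _) (norm_nonneg _) two_ne_zero).1 h2

/-- `‖e₃ × v‖ ≤ ‖v‖` (`‖e₃‖ = 1`). [folklore] -/
theorem norm_cross_single_two_le (v : EuclideanSpace ℝ (Fin 3)) : ‖cross (EuclideanSpace.single 2 (1:ℝ)) v‖ ≤ ‖v‖ := by
  have h := Literature.Analysis.FluidPDE.VortexStretchingDynamics.norm_cross_sq (EuclideanSpace.single 2 (1:ℝ)) v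
  have he : ‖(EuclideanSpace.single (2 : Fin 3) (1:ℝ) : EuclideanSpace ℝ (Fin 3))‖ = 1 := by simp
  rw [he, one_pow, one_mul] at h
  have h2 : ‖cross (EuclideanSpace.single 2 (1:ℝ)) v‖ ^ 2 ≤ ‖v‖ ^ 2 := by rw [h]; nlinarith [sq_nonneg ⟪EuclideanSpace.single (2 : Fin 3) (1:ℝ), v⟫]
  exact (pow_le_pow_iff_left₀ (norm_nonneg _) (norm_nonneg _) two_ne_zero).1 h2

/-- **Tilt bound for the binormal rate vector**: for a unit tangent with `|⟪t, e₃⟫| ≤ 1 − θ₀`, `‖e₃ × t‖² ≥ θ₀(2 − θ₀)`. [folklore] -/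
theorem norm_cross_single_two_sq_ge {t : EuclideanSpace ℝ (Fin 3)} (ht : ‖t‖ = 1) {θ₀ : ℝ}
    (htilt : |⟪t, EuclideanSpace.single 2 (1:ℝ)⟫| ≤ 1 - θ₀) :
    θ₀ * (2 - θ₀) ≤ ‖cross (EuclideanSpace.single 2 (1:ℝ)) t‖ ^ 2 := by
  have h := Literature.Analysis.FluidPDE.VortexStretchingDynamics.norm_cross_sq (EuclideanSpace.single 2 (1:ℝ)) t
  have he : ‖(EuclideanSpace.single (2 : Fin 3) (1:ℝ) : EuclideanSpace ℝ (Fin 3))‖ = 1 := by simp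
  rw [he, one_pow, one_mul, ht, one_pow, real_inner_comm] at h
  rw [h]
  have hsq : ⟪t, EuclideanSpace.single 2 (1:ℝ)⟫ ^ 2 ≤ (1 - θ₀) ^ 2 := by
    have := sq_le_sq' (by linarith [abs_le.1 htilt |>.1]) (abs_le.1 htilt).2
    simpa using this
  nlinarith

/-- **The rate column along a STRAIGHT filament** `X(τ) = x₀ + τ·t` splits as `P_t(e₃ × x₀) + τ·(e₃ × t)`. [folklore] -/
theorem rateColumn_straight (x₀ t : EuclideanSpace ℝ (Fin 3)) (τ : ℝ) :
    cross (EuclideanSpace.single 2 (1:ℝ)) (x₀ + τ • t) - ⟪cross (EuclideanSpace.single 2 (1:ℝ)) (x₀ + τ • t), t⟫ • t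
      = (cross (EuclideanSpace.single 2 (1:ℝ)) x₀ - ⟪cross (EuclideanSpace.single 2 (1:ℝ)) x₀, t⟫ • t)
        + τ • cross (EuclideanSpace.single 2 (1:ℝ)) t := by
  have hlin : cross (EuclideanSpace.single 2 (1:ℝ)) (x₀ + τ • t)
      = cross (EuclideanSpace.single 2 (1:ℝ)) x₀ + τ • cross (EuclideanSpace.single 2 (1:ℝ)) t := by
    ext i; fin_cases i <;> simp [cross, crossProduct, add_comm]
  have hperp : ⟪cross (EuclideanSpace.single 2 (1:ℝ)) t, t⟫ = 0 :=
    Literature.Analysis.FluidPDE.Tao2016.inner_cross_self_right _ _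
  rw [hlin, inner_add_left, inner_smul_left, hperp]
  simp only [conj_trivial, mul_zero, add_zero]
  abel

/-- **RATE-COLUMN FLOOR on a straight filament**: `‖R(τ)‖ ≥ |τ|·√(θ₀(2−θ₀)) − ‖x₀‖` for `X(τ) = x₀ + τ·t`, `‖t‖ = 1`, `|⟪t, e₃⟫| ≤ 1 − θ₀`. [folklore] -/
theorem rateColumn_norm_ge (x₀ t : EuclideanSpace ℝ (Fin 3)) (ht : ‖t‖ = 1) {θ₀ : ℝ}
    (htilt : |⟪t, EuclideanSpace.single 2 (1:ℝ)⟫| ≤ 1 - θ₀) (τ : ℝ) :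
    |τ| * Real.sqrt (θ₀ * (2 - θ₀)) - ‖x₀‖
      ≤ ‖cross (EuclideanSpace.single 2 (1:ℝ)) (x₀ + τ • t) - ⟪cross (EuclideanSpace.single 2 (1:ℝ)) (x₀ + τ • t), t⟫ • t‖ := by
  rw [rateColumn_straight x₀ t τ]
  set P0 : EuclideanSpace ℝ (Fin 3) := cross (EuclideanSpace.single 2 (1:ℝ)) x₀ - ⟪cross (EuclideanSpace.single 2 (1:ℝ)) x₀, t⟫ • t with hP0
  set b : EuclideanSpace ℝ (Fin 3) := cross (EuclideanSpace.single 2 (1:ℝ)) t with hb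
  -- `‖P0 + τ b‖ ≥ ‖τ b‖ − ‖P0‖`, `‖τ b‖ = |τ|‖b‖ ≥ |τ|√(θ₀(2−θ₀))`, `‖P0‖ ≤ ‖e₃ × x₀‖ ≤ ‖x₀‖`
  have h1 : ‖τ • b‖ - ‖P0‖ ≤ ‖P0 + τ • b‖ := by
    have h := norm_sub_le (P0 + τ • b) P0
    rw [show P0 + τ • b - P0 = τ • b by abel] at h
    linarith
  have h2 : ‖τ • b‖ = |τ| * ‖b‖ := by rw [norm_smul, Real.norm_eq_abs]
  have h3 : Real.sqrt (θ₀ * (2 - θ₀)) ≤ ‖b‖ := by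
    have := norm_cross_single_two_sq_ge ht htilt
    rw [← hb] at this
    calc Real.sqrt (θ₀ * (2 - θ₀)) ≤ Real.sqrt (‖b‖ ^ 2) := Real.sqrt_le_sqrt this
      _ = ‖b‖ := Real.sqrt_sq (norm_nonneg _)
  have h4 : ‖P0‖ ≤ ‖x₀‖ :=
    (norm_sub_inner_smul_le _ t ht).trans (norm_cross_single_two_le x₀)
  have h5 : |τ| * Real.sqrt (θ₀ * (2 - θ₀)) ≤ |τ| * ‖b‖ := mul_le_mul_of_nonneg_left h3 (abs_nonneg τ)
  linarith

end Summit.NavierStokesRegularity.NavierStokesRegularity.Theorems.MatchedKernel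

end
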